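import Summits.ValiantsHypothesis.ValiantsHypothesis.Theses.ShallowShadows
import Literature.Computability.Complexity.MonotoneMatchingDepth
import Literature.Barriers.PneNP.TSPExtensionComplexityRothvossTransport
import Summits.ValiantsHypothesis.ValiantsHypothesis.Theorems.RazWigdersonMatching.Negative.ThresholdAndNonVacuity

/-!
# Line `rothvoss-planted` — crux `RazWigdersonMatching` (item `stmt-ValiantsHypothesis-17127`), route `ShallowShadows`

Crux (FAR SIDE of the shadow transfer of route `route-ValiantsHypothesis-ShallowShadows`):
`Summit.ValiantsHypothesis.ValiantsHypothesis.Theses.ShallowShadows.RazWigdersonMatching` —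
`∃ c > 0, ∃ m₀, ∀ m ≥ m₀, 2 ^ (c·m) ≤ formulaSizeOver monotoneBasis (perfectMatchingFn m)`
(monotone formulas for bipartite perfect matching on `K_{m,m}` have size `2^{Ω(m)}`;
Raz–Wigderson, J. ACM 39 (1992) Thm. 4.2 + formula balancing).

## The strategy (crux-strategist, ALT line to `Lines/birth.lean`)

The birth line isolates the whole communication-complexity content in ONE XL stub
(`stub_depth` = RW Thm. 4.2: KW games + the `Ω(n)` RANDOMIZED communication complexity of
DISJOINTNESS (Kalyanasundaram–Schnitger / Razborov 1992) + RW's four-step randomized reduction),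
for which the tree has no two-party protocol type and no distributional-disjointness theorem, and
then needs the Formula Balancing Lemma (L) to pass from depth to formula size.

This line replaces randomized disjointness by a theorem that is ALREADY KERNEL-CHECKED IN THE
TREE: Rothvoss's rectangle lemma for the perfect-matching slack matrix (Rothvoss, J. ACM 64
(2017) 41, Lemma 6 — `Literature.Barriers.PneNP.rect_le` / `exists_W_slot` in
`Literature/Barriers/PneNP/TSPExtensionComplexityRothvossProofs.lean`, consumed by
`Literature.Computability.Complexity.rothvoss_matching_slack_bound_holds`): there is a weight
matrix `W = μ₃ - μ_k/(k-1) - 𝟙_{Q₁}` on (`t`-vertex-cuts `U`) × (perfect matchings `M` of `K_N`)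
all of whose RECTANGLE SUMS are `≤ 2^{-δ N}`, with `μ₃`, `μ_k` probability measures on the
pairs with `|δ(U) ∩ M| = 3`, resp. `= k`.  The bridge from a monotone FORMULA to rectangles is
DETERMINISTIC, short, and needs neither depth nor balancing:

1. (KW, leaf form — `stub_kwPartition`) a monotone formula with `s` gates for `f` yields a
   partition of `f⁻¹(1) × f⁻¹(0)` into `L ≤ s + 1` rectangles (its leaves), each labelled by a
   variable `i` with `x_i = 1`, `y_i = 0` on it (Karchmer–Wigderson 1990; Rao–Yehudayoff
   Lemma 9.2; Rychkov's lemma, Jukna 2012 §3.3).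
2. (PLANTED TWO-RUN STATISTIC — `stub_plantedTwoRun`, the new lever) embed a pair
   (`M` perfect matching of `K_N`, `U ⊆ [N]`) into the KW game of `BPM_n`, `n > N`:
   Alice's perfect matching of `K_{n,n}` is `{(v, M(v)) : v < N} ∪ {(N,N)} ∪ {(i,i) : i > N}`,
   Bob's PM-free graph is the union of the `n - 1` lines {rows `v < N`, `v ∉ U`} ∪ {rows `> N`}
   ∪ {columns `v < N`, `v ∈ U`}.  The KW answers are exactly the `s = |δ(U) ∩ M|` crossing
   edges `(u, M(u))`, `u ∈ U`, `M(u) ∉ U`, plus the PLANTED edge `(N,N)`, and the stabiliser of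
   the instance in `S_n × S_n` (row/column relabellings) acts TRANSITIVELY on these `s + 1`
   answers (explicit transpositions).  Hence, relabelling by a uniformly random
   `τ ∈ S_n × S_n` (Rao–Yehudayoff, proof of Thm. 9.5) the pulled-back answer of ANY
   deterministic KW partition is UNIFORM on the `s + 1` answers, and for two independent
   relabellings the event "both answers are crossing edges and they differ" has probability
   EXACTLY `g(s) = s(s-1)/(s+1)²` — which VANISHES for `s = 1` (the pairs `Q₁` where Rothvoss's
   `W` carries the `-∞`/penalty) and is `3/8` for `s = 3`.  Unfolding the two runs over the
   leaf pairs writes `g(|δ(U) ∩ M|)` as a NON-NEGATIVE combination of rectangles of total weight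
   `≤ L²` (the number of public coins does not enter).  Checked numerically for `N ≤ 4`,
   `n ≤ 5`, three different deterministic answer rules (folder `evidence/s4check.py`: exact
   uniformity and exact value of the statistic in every case).
3. (ROTHVOSS — `stub_rothvossWeights`) the structured weight datum, transported from the slot
   model to `Fin N` for some `N < n`, `N ≥ n - 433`.
4. Composition (PROVED below, `RazWigdersonMatching_of`): `⟨W, g⟩ = Σ_j w_j ⟨W, R_j⟩ ≤ L² 2^{-δn}`
   while `⟨W, g⟩ = g(3)·1 - (≤ 1/3)·(≤ 1) - 0 ≥ 1/24`; so `(s+1)² ≥ 2^{δ n}/24` and, with the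
   non-vacuity of `formulaSizeOver` (proved, Negative lemma), the minimal formula size is
   `≥ 2^{δ n / 8}` for `δ n ≥ 10`, `δ n ≥ 8`.

Three stubs, none XL: S1 `stub_kwPartition` (M–L, printed lemma in the tree's straight-line
circuit model), S2 `stub_plantedTwoRun` (L, elementary: permutation action, two kinds of
transpositions, counting — the HARDEST and load-bearing stub), S3 `stub_rothvossWeights` (M,
transport of an in-tree theorem + reading off the structure of `Wmat`). Non-vacuity of
`formulaSizeOver` (the birth line's `stub_formulaExists`) is NOT a stub here: it is discharged by
the landed Negative lemma `exists_monotoneFormula_perfectMatchingFn` (p149969).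

Disproof used (Cruxes/RazWigdersonMatching/Disproof.lean, refuter-rattack 2026-08-17):
`razWigdersonMatching_false_without_threshold` — honoured: the composition USES the threshold
(`m ≥ max n₀ (max 1 (max ⌈10/δ⌉ ⌈8/δ⌉))`); non-vacuity lemma (b) is imported and used
(`bpmMonotoneFormulaExists_holds`); no strengthening refuted there is assumed by any stub (the
stubs concern KW rectangles, the planted statistic and Rothvoss's datum, not the circuit form (c)).

References: [RazWigderson1992] Thm. 4.2; [KarchmerWigderson1990]; Rao–Yehudayoff,
*Communication Complexity* (CUP 2020), Lemma 9.2 and Thm. 9.5 (planted-edge reduction);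
[Rothvoss2017] Lemma 6 (arXiv:1311.2369); [Jukna2012] Lemma 6.1, Cor. 7.27;
[CavalarEtAl2026] §1.2 (arXiv:2507.16105).
-/

set_option linter.dupNamespace false

noncomputable section

open scoped Classical

namespace Summit.ValiantsHypothesis.ValiantsHypothesis.Cruxes.RazWigdersonMatching.RothvossPlanted

open Finset
open Literature.Computability.Complexity
open Literature.Barriers.PneNP (perfectMatchingFn IsPMOn cutCount)
open Summit.ValiantsHypothesis.ValiantsHypothesis.Theses.ShallowShadows (RazWigdersonMatching)

/-! ## Vocabulary -/

/-- `t`-subsets of `Fin N` (Bob's side: vertex cuts `U`, `|U| = t`). -/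
abbrev TCut (N t : ℕ) : Type := {U : Finset (Fin N) // U.card = t}

/-- Perfect matchings of `K_N` as edge finsets (Alice's side), the tree's `IsPMOn univ`. -/
abbrev PMatch (N : ℕ) : Type := {M : Finset (Sym2 (Fin N)) // IsPMOn Finset.univ M}

/-- The crossing number `|δ(U) ∩ M|`: edges of `M` with exactly one endpoint in `U`
(the tree's `cutCount U e = 1`). -/
def crossCount {N : ℕ} (U : Finset (Fin N)) (M : Finset (Sym2 (Fin N))) : ℕ :=
  (M.filter fun e => cutCount U e = 1).card

/-- The two-run statistic `g(s) = s(s-1)/(s+1)²` of a pair with `s` crossing edges: the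
probability that two independent uniform samples from `s + 1` answers (the `s` crossing edges and
one planted edge) are two DISTINCT crossing edges. `g 0 = g 1 = 0`, `g 3 = 3/8`, `g s < 1`. -/
def twoRunStat (s : ℕ) : ℝ := ((s : ℝ) * ((s : ℝ) - 1)) / ((s : ℝ) + 1) ^ 2

/-- `g 1 = 0`: with a unique crossing edge two runs can never return two DISTINCT crossing edges —
the statistic vanishes exactly where Rothvoss's penalty lives. -/
theorem twoRunStat_one : twoRunStat 1 = 0 := by norm_num [twoRunStat]

/-- `g 3 = 3/8`. -/
theorem twoRunStat_three : twoRunStat 3 = 3 / 8 := by norm_num [twoRunStat]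

/-- `0 ≤ g s`. -/
theorem twoRunStat_nonneg (s : ℕ) : 0 ≤ twoRunStat s := by
  unfold twoRunStat
  rcases Nat.eq_zero_or_pos s with rfl | hs
  · norm_num
  · apply div_nonneg
    · have : (1 : ℝ) ≤ s := by exact_mod_cast hs
      nlinarith
    · positivity

/-- `g s ≤ 1` (a probability). -/
theorem twoRunStat_le_one (s : ℕ) : twoRunStat s ≤ 1 := by
  unfold twoRunStat
  rw [div_le_one (by positivity)]
  nlinarith [Nat.cast_nonneg (α := ℝ) s]

/-! ## The five stub statements -/

/-- NON-VACUITY (= the birth line's `BPMMonotoneFormulaExists` / `stub_formulaExists`, verbatim):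
for `m ≥ 1` the bipartite perfect matching function has SOME monotone formula (its DNF), so
`formulaSizeOver monotoneBasis (perfectMatchingFn m)` is an attained minimum, not the junk `0`.
NOT A STUB on this line: it is PROVED in the tree by the landed Negative lemma file of this crux
(`…Theorems.RazWigdersonMatching.Negative.exists_monotoneFormula_perfectMatchingFn`, p149969) —
`bpmMonotoneFormulaExists_holds` below. [folklore; Jukna2012 §1.1] -/
def BPMMonotoneFormulaExists : Prop :=
  ∀ m : ℕ, 1 ≤ m → ∃ F : Circuit (Fin m × Fin m),
    F.IsOver monotoneBasis ∧ F.IsFormula ∧ F.Computes (perfectMatchingFn m)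

/-- Non-vacuity HOLDS (discharged by the landed Negative lemma of this crux, p149969). -/
theorem bpmMonotoneFormulaExists_holds : BPMMonotoneFormulaExists :=
  fun m hm => Summit.ValiantsHypothesis.ValiantsHypothesis.Theorems.RazWigdersonMatching.Negative.exists_monotoneFormula_perfectMatchingFn m hm

/-- S1 — KARCHMER–WIGDERSON, monotone, LEAF (partition-number) form: a FORMULA `C` over
`{∧₂, ∨₂}` with `C.size` gates computing `f` yields at most `C.size + 1` rectangles `A l × B l`
(one per leaf of the formula tree below the output: a fan-in-2 tree with `g ≤ C.size` gates has
`g + 1` leaves), labelled by variables `lab l`, such that every pair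
`(x, y) ∈ f⁻¹(1) × f⁻¹(0)` lies in EXACTLY ONE of them and the label is a valid answer of the
monotone KW game there (`x (lab l) = 1`, `y (lab l) = 0`). Proof in print: walk down from the
output — at an `∨` gate Alice names the first child that is `1` on `x`, at an `∧` gate Bob names
the first child that is `0` on `y`; the leaf reached is the part, its variable the label
(Karchmer–Wigderson 1990; Rao–Yehudayoff Lemma 9.2 and the remark after it, "every input gate
corresponds to a leaf in the protocol tree"; the leaves of a protocol are disjoint rectangles —
Rychkov's lemma / the protocol partition number, Jukna 2012 §3.3). In the tree's straight-line
model: strong induction on the gate index with `CircuitSemantics.transcript` / `gateValue`; under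
`IsFormula` (`refCount ≤ 1`) the gates reachable from the output form a tree, and the children's
rectangles are restricted to `{x : g₁ x = 1}` resp. `{x : g₁ x = 0}` (Alice) / dually (Bob).
NO DEPTH and NO BALANCING is needed on this line. [KarchmerWigderson1990; RaoYehudayoff2020
Lemma 9.2; Jukna2012 §3.3 (Rychkov) — size M–L] -/
def MonotoneKWPartition : Prop :=
  ∀ (ι : Type) [Fintype ι] [DecidableEq ι] (f : (ι → Bool) → Bool) (C : Circuit ι),
    C.IsOver monotoneBasis → C.IsFormula → C.Computes f →
      ∃ L : ℕ, L ≤ C.size + 1 ∧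
        ∃ (A : Fin L → Set (ι → Bool)) (B : Fin L → Set (ι → Bool)) (lab : Fin L → ι),
          (∀ x y, f x = true → f y = false → ∃! l, x ∈ A l ∧ y ∈ B l) ∧
          (∀ l x y, x ∈ A l → y ∈ B l → f x = true → f y = false →
            x (lab l) = true ∧ y (lab l) = false)

/-- S2 — THE PLANTED TWO-RUN STATISTIC (the lever of this line; Rao–Yehudayoff's planted-edge
symmetrisation, Thm. 9.5, run twice). Given ANY labelled rectangle partition of the monotone KW
game of `perfectMatchingFn n` with `L` parts (as produced by S1) and `N < n`, the function
`(U, M) ↦ g(|δ(U) ∩ M|)`, `g s = s(s-1)/(s+1)²`, on (`t`-cuts of `Fin N`) × (perfect matchings of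
`K_N`) is a non-negative combination of rectangles of total weight `≤ L²`.
Construction: embed `M ↦ x_M` = the permutation matrix `{(v, M v) : v < N} ∪ {(N, N)} ∪
{(i, i) : i > N}` (a `1`-input), `U ↦ y_U` = union of the `n - 1` lines (rows `v < N`, `v ∉ U`),
(rows `i > N`), (columns `v < N`, `v ∈ U`) (a `0`-input: `n - 1` lines cover no perfect matching);
the answers `{e : x_M e = 1, y_U e = 0}` are the `s` crossing edges `(u, M u)`, `u ∈ U`,
`M u ∉ U`, and the planted `(N, N)`; the stabiliser of `(x_M, y_U)` in `S_n × S_n` is transitive on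
them (transpositions `(N u)(N, M u)` and `(u u')(v v')`), so for the pulled-back answer
`ans τ = τ⁻¹ · lab (part (τ x_M, τ y_U))` every answer has exactly `|S_n × S_n|/(s+1)` preimages
`τ`; over pairs `(τ¹, τ²)` the event [both answers crossing and distinct] has exactly
`s(s-1) (|S_n|²/(s+1))²` elements and is, for fixed `(τ¹, τ²)`, a disjoint union over leaf pairs
`(l₁, l₂)` (a condition on `τ¹, τ², lab l₁, lab l₂` only) of the rectangles
`{U : τ¹y_U ∈ B l₁, τ²y_U ∈ B l₂} × {M : τ¹x_M ∈ A l₁, τ²x_M ∈ A l₂}`; weights `1/|S_n × S_n|²`.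
[RaoYehudayoff2020 Thm. 9.5 (planted edge, random relabelling); RazWigderson1992 Props. 3.2–3.3
and Thm. 4.2 (vertex duplication); new: the two-run statistic — size L] -/
def PlantedTwoRunStatistic : Prop :=
  ∀ (n N t L : ℕ), N < n →
    ∀ (A : Fin L → Set (Fin n × Fin n → Bool)) (B : Fin L → Set (Fin n × Fin n → Bool))
      (lab : Fin L → Fin n × Fin n),
      (∀ x y, perfectMatchingFn n x = true → perfectMatchingFn n y = false →
          ∃! l, x ∈ A l ∧ y ∈ B l) →
      (∀ l x y, x ∈ A l → y ∈ B l → perfectMatchingFn n x = true →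
          perfectMatchingFn n y = false → x (lab l) = true ∧ y (lab l) = false) →
      ∃ (J : ℕ) (w : Fin J → ℝ) (X : Fin J → Finset (TCut N t)) (Y : Fin J → Finset (PMatch N)),
        (∀ j, 0 ≤ w j) ∧ (∑ j, w j ≤ (L : ℝ) ^ 2) ∧
        ∀ (U : TCut N t) (M : PMatch N),
          ∑ j, w j * ((if U ∈ X j then (1 : ℝ) else 0) * (if M ∈ Y j then (1 : ℝ) else 0)) =
            twoRunStat (crossCount U.1 M.1)

/-- S3 — ROTHVOSS'S WEIGHT DATUM, structured form on `Fin N` (Rothvoss 2017, Lemma 6 and §2,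
eq. (2); IN THE TREE on the slot model: `Literature.Barriers.PneNP.Wmat` =
`-𝟙[|δ(U)∩M| = 1] + kern3 - kernK/(q+2)` with `kern3, kernK ≥ 0` supported on `|δ(U) ∩ M| = 3`,
resp. `= q + 3`, each of total mass `1` over (`tCut`-cuts) × (perfect matchings)
(`sum_kern3_slack`, `sum_kernK_slack`, `cut_eq_H`, `card_Hm`), and `rect_le` / `exists_W_slot`:
ALL rectangle sums `≤ 2θ`, `θ = 2^{-δ_R m}` on `Slot m 72`, `|Slot m 72| = 216 m + 150`,
`m` odd; parameters as instantiated in `rothvoss_matching_slack_bound_holds`). For every large `n`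
pick the largest slot size `N = 216 m + 150 < n` (so `N ≥ n - 433`), transport along
`Slot m 72 ≃ Fin N` as in `exists_weights_transport` (cuts by `Finset.map`, matchings by
`Sym2.map`, `|δ(U) ∩ M|` invariant: `card_cut_image`), and absorb `2θ ≤ 2^{-δ n}` into `δ`.
[Rothvoss2017 Lemma 6 (arXiv:1311.2369); in-tree: TSPExtensionComplexityRothvossProofs,
MatchingExtensionComplexityHolds — size M] -/
def RothvossWeightDatum : Prop :=
  ∃ δ : ℝ, 0 < δ ∧ ∃ n₀ : ℕ, ∀ n ≥ n₀, ∃ N t : ℕ, N < n ∧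
    ∃ (W Wpos Wneg Wpen : TCut N t → PMatch N → ℝ),
      (∀ U M, W U M = Wpos U M - Wneg U M - Wpen U M) ∧
      (∀ U M, 0 ≤ Wpos U M) ∧ (∀ U M, 0 ≤ Wneg U M) ∧ (∀ U M, 0 ≤ Wpen U M) ∧
      (∀ U M, Wpos U M ≠ 0 → crossCount U.1 M.1 = 3) ∧
      (∀ U M, Wpen U M ≠ 0 → crossCount U.1 M.1 = 1) ∧
      (∑ U, ∑ M, Wpos U M = 1) ∧ (∑ U, ∑ M, Wneg U M ≤ 1 / 3) ∧
      (∀ (X : Finset (TCut N t)) (Y : Finset (PMatch N)),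
        ∑ U ∈ X, ∑ M ∈ Y, W U M ≤ (2 : ℝ) ^ (-(δ * n)))

/-! ## Wiring checks against the birth line / Literature facts -/


/-! ## Registered stubs -/

/-- STUB `stub_kwPartition` (signature = `MonotoneKWPartition` verbatim): Karchmer–Wigderson
simulation of a monotone circuit by its leaf rectangles. [KarchmerWigderson1990;
RaoYehudayoff2020 Lemma 9.2 — size M–L] -/
theorem stub_kwPartition :
    ∀ (ι : Type) [Fintype ι] [DecidableEq ι] (f : (ι → Bool) → Bool) (C : Circuit ι),
      C.IsOver monotoneBasis → C.IsFormula → C.Computes f →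
        ∃ L : ℕ, L ≤ C.size + 1 ∧
          ∃ (A : Fin L → Set (ι → Bool)) (B : Fin L → Set (ι → Bool)) (lab : Fin L → ι),
            (∀ x y, f x = true → f y = false → ∃! l, x ∈ A l ∧ y ∈ B l) ∧
            (∀ l x y, x ∈ A l → y ∈ B l → f x = true → f y = false →
              x (lab l) = true ∧ y (lab l) = false) := by
  sorry

/-- STUB `stub_plantedTwoRun` (signature = `PlantedTwoRunStatistic` verbatim): the planted
two-run statistic is an exact rectangle combination of weight `≤ L²`. THE HARDEST / load-bearing
stub of the line. [RaoYehudayoff2020 Thm. 9.5; RazWigderson1992 Thm. 4.2 — size L] -/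
theorem stub_plantedTwoRun :
    ∀ (n N t L : ℕ), N < n →
      ∀ (A : Fin L → Set (Fin n × Fin n → Bool)) (B : Fin L → Set (Fin n × Fin n → Bool))
        (lab : Fin L → Fin n × Fin n),
        (∀ x y, perfectMatchingFn n x = true → perfectMatchingFn n y = false →
            ∃! l, x ∈ A l ∧ y ∈ B l) →
        (∀ l x y, x ∈ A l → y ∈ B l → perfectMatchingFn n x = true →
            perfectMatchingFn n y = false → x (lab l) = true ∧ y (lab l) = false) →
        ∃ (J : ℕ) (w : Fin J → ℝ) (X : Fin J → Finset (TCut N t)) (Y : Fin J → Finset (PMatch N)),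
          (∀ j, 0 ≤ w j) ∧ (∑ j, w j ≤ (L : ℝ) ^ 2) ∧
          ∀ (U : TCut N t) (M : PMatch N),
            ∑ j, w j * ((if U ∈ X j then (1 : ℝ) else 0) * (if M ∈ Y j then (1 : ℝ) else 0)) =
              twoRunStat (crossCount U.1 M.1) := by
  sorry

/-- STUB `stub_rothvossWeights` (signature = `RothvossWeightDatum` verbatim): Rothvoss's Lemma 6
weight datum in structured form on `Fin N`, `N < n`, `N ≥ n - 433` — a transport of the in-tree
theorem `Literature.Barriers.PneNP.exists_W_slot` / `rect_le` plus the structure of `Wmat`.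
[Rothvoss2017 Lemma 6 — size M] -/
theorem stub_rothvossWeights :
    ∃ δ : ℝ, 0 < δ ∧ ∃ n₀ : ℕ, ∀ n ≥ n₀, ∃ N t : ℕ, N < n ∧
      ∃ (W Wpos Wneg Wpen : TCut N t → PMatch N → ℝ),
        (∀ U M, W U M = Wpos U M - Wneg U M - Wpen U M) ∧
        (∀ U M, 0 ≤ Wpos U M) ∧ (∀ U M, 0 ≤ Wneg U M) ∧ (∀ U M, 0 ≤ Wpen U M) ∧
        (∀ U M, Wpos U M ≠ 0 → crossCount U.1 M.1 = 3) ∧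
        (∀ U M, Wpen U M ≠ 0 → crossCount U.1 M.1 = 1) ∧
        (∑ U, ∑ M, Wpos U M = 1) ∧ (∑ U, ∑ M, Wneg U M ≤ 1 / 3) ∧
        (∀ (X : Finset (TCut N t)) (Y : Finset (PMatch N)),
          ∑ U ∈ X, ∑ M ∈ Y, W U M ≤ (2 : ℝ) ^ (-(δ * n))) := by
  sorry

/-! ## Name-keyed aliases -/
namespace Registered
/-- Alias of `MonotoneKWPartition` (= the signature of `stub_kwPartition`). -/
abbrev stub_kwPartition : Prop := MonotoneKWPartition
/-- Alias of `PlantedTwoRunStatistic` (= the signature of `stub_plantedTwoRun`). -/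
abbrev stub_plantedTwoRun : Prop := PlantedTwoRunStatistic
/-- Alias of `RothvossWeightDatum` (= the signature of `stub_rothvossWeights`). -/
abbrev stub_rothvossWeights : Prop := RothvossWeightDatum
end Registered

/-! ## Helper (sorry-free): rectangle indicator sums -/

/-- `Σ_{a,b} W a b · 𝟙[a ∈ X] 𝟙[b ∈ Y] = Σ_{a ∈ X} Σ_{b ∈ Y} W a b` (rectangle sums). -/
theorem sum_mul_indicator_rect {α β : Type} [Fintype α] [Fintype β] [DecidableEq α]
    [DecidableEq β] (W : α → β → ℝ) (X : Finset α) (Y : Finset β) :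
    ∑ a, ∑ b, W a b * ((if a ∈ X then (1 : ℝ) else 0) * (if b ∈ Y then (1 : ℝ) else 0)) =
      ∑ a ∈ X, ∑ b ∈ Y, W a b := by
  have inner : ∀ a, ∑ b, W a b * ((if a ∈ X then (1 : ℝ) else 0) * (if b ∈ Y then (1 : ℝ) else 0))
      = if a ∈ X then ∑ b ∈ Y, W a b else 0 := by
    intro a
    by_cases ha : a ∈ X
    · simp only [ha, if_true, one_mul]
      have hb : ∀ b, W a b * (if b ∈ Y then (1 : ℝ) else 0) = if b ∈ Y then W a b else 0 :=
        fun b => by split_ifs <;> simp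
      rw [Finset.sum_congr rfl (fun b _ => hb b), Finset.sum_ite_mem, Finset.univ_inter]
    · simp [ha]
  rw [Finset.sum_congr rfl (fun a _ => inner a), Finset.sum_ite_mem, Finset.univ_inter]


/-! ## Composition (kernel-checked, sorry-free) -/

/-- **Composition.** The KW leaf partition (S1) of a minimal monotone formula for `PM_m`
(attained: non-vacuity is proved; `s` gates) has `L ≤ s + 1` parts; the planted two-run
statistic (S2) writes `g(|δ(U) ∩ M|)` as a non-negative rectangle combination of total weight
`≤ L²`; pairing it with Rothvoss's weight datum (S3) gives `1/24 ≤ ⟨W, g⟩ ≤ L² · 2^{-δ m}`, whence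
`(s + 1)² ≥ 2^{δ m}/24 ≥ 2^{δ m / 2}` (`δ m ≥ 10`) and `s ≥ 2^{δ m/4} - 1 ≥ 2^{δ m / 8}`:
`c = δ / 8`, `m₀ = max n₀ (max 1 (max ⌈10/δ⌉ ⌈8/δ⌉))`. No depth, no balancing. -/
theorem RazWigdersonMatching_of :
    Registered.stub_kwPartition → Registered.stub_plantedTwoRun → Registered.stub_rothvossWeights →
      RazWigdersonMatching := by
  rintro hkw hpl ⟨δ, hδ, n₀, hroth⟩
  have hex : BPMMonotoneFormulaExists := bpmMonotoneFormulaExists_holds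
  set c : ℝ := δ / 8 with hc_def
  have hc : 0 < c := by positivity
  refine ⟨c, hc, max n₀ (max 1 (max ⌈10 / δ⌉₊ ⌈1 / c⌉₊)), ?_⟩
  intro m hm
  have hmn₀ : n₀ ≤ m := le_trans (le_max_left _ _) hm
  have hm1 : 1 ≤ m := le_trans ((le_max_left _ _).trans (le_max_right _ _)) hm
  have hm10 : ⌈10 / δ⌉₊ ≤ m :=
    le_trans (((le_max_left _ _).trans (le_max_right _ _)).trans (le_max_right _ _)) hm
  have hmc : ⌈1 / c⌉₊ ≤ m :=
    le_trans (((le_max_right _ _).trans (le_max_right _ _)).trans (le_max_right _ _)) hm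
  have hδm : 10 ≤ δ * m := by
    have h1 : 10 / δ ≤ ⌈10 / δ⌉₊ := Nat.le_ceil _
    have h2 : (⌈10 / δ⌉₊ : ℝ) ≤ m := by exact_mod_cast hm10
    have h3 : 10 / δ ≤ m := h1.trans h2
    rw [div_le_iff₀ hδ] at h3
    linarith
  have hcm1 : 1 ≤ c * m := by
    have h1 : 1 / c ≤ ⌈1 / c⌉₊ := Nat.le_ceil _
    have h2 : (⌈1 / c⌉₊ : ℝ) ≤ m := by exact_mod_cast hmc
    have h3 : 1 / c ≤ m := h1.trans h2
    rw [div_le_iff₀ hc] at h3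
    linarith
  -- non-vacuity (proved): the infimum defining `formulaSizeOver` is attained by a formula `F`
  have hSne : {s | ∃ C : Circuit (Fin m × Fin m), C.IsOver monotoneBasis ∧ C.IsFormula ∧
      C.Computes (perfectMatchingFn m) ∧ C.size = s}.Nonempty := by
    obtain ⟨F, hF₁, hF₂, hF₃⟩ := hex m hm1
    exact ⟨F.size, F, hF₁, hF₂, hF₃, rfl⟩
  obtain ⟨F, hFover, hFformula, hFcomp, hFsize⟩ := Nat.sInf_mem hSne
  have hfs : formulaSizeOver monotoneBasis (perfectMatchingFn m) = F.size := by
    unfold formulaSizeOver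
    exact hFsize.symm
  -- S1: the KW leaf partition of `F`
  obtain ⟨L, hL, A, B, lab, hpart, hvalid⟩ :=
    hkw (Fin m × Fin m) (perfectMatchingFn m) F hFover hFformula hFcomp
  -- S3: Rothvoss's weight datum at `n := m`
  obtain ⟨N, t, hNm, W, Wpos, Wneg, Wpen, hW, hpos0, hneg0, hpen0, hpos3, hpen1, hposSum,
    hnegSum, hrect⟩ := hroth m hmn₀
  -- S2: the planted two-run statistic as a rectangle combination
  obtain ⟨J, w, X, Y, hw0, hwsum, hstat⟩ := hpl m N t L hNm A B lab hpart hvalid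
  -- `Φ = ⟨W, g⟩` two ways
  set Φ : ℝ := ∑ U : TCut N t, ∑ M : PMatch N, W U M * twoRunStat (crossCount U.1 M.1) with hΦ
  have hupper : Φ ≤ (L : ℝ) ^ 2 * (2 : ℝ) ^ (-(δ * m)) := by
    have h1 : Φ = ∑ j, w j * ∑ U ∈ X j, ∑ M ∈ Y j, W U M := by
      have h2 : ∀ (U : TCut N t) (M : PMatch N), W U M * twoRunStat (crossCount U.1 M.1) =
          ∑ j, w j * (W U M * ((if U ∈ X j then (1 : ℝ) else 0) *
            (if M ∈ Y j then (1 : ℝ) else 0))) := by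
        intro U M
        rw [← hstat U M, Finset.mul_sum]
        refine Finset.sum_congr rfl fun j _ => ?_
        ring
      calc Φ = ∑ U : TCut N t, ∑ M : PMatch N, ∑ j, w j * (W U M *
              ((if U ∈ X j then (1 : ℝ) else 0) * (if M ∈ Y j then (1 : ℝ) else 0))) := by
            rw [hΦ]
            refine Finset.sum_congr rfl fun U _ => Finset.sum_congr rfl fun M _ => h2 U M
        _ = ∑ U : TCut N t, ∑ j, ∑ M : PMatch N, w j * (W U M *
              ((if U ∈ X j then (1 : ℝ) else 0) * (if M ∈ Y j then (1 : ℝ) else 0))) := by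
            refine Finset.sum_congr rfl fun U _ => ?_
            rw [Finset.sum_comm]
        _ = ∑ j, ∑ U : TCut N t, ∑ M : PMatch N, w j * (W U M *
              ((if U ∈ X j then (1 : ℝ) else 0) * (if M ∈ Y j then (1 : ℝ) else 0))) := by
            rw [Finset.sum_comm]
        _ = ∑ j, w j * ∑ U ∈ X j, ∑ M ∈ Y j, W U M := by
            refine Finset.sum_congr rfl fun j _ => ?_
            rw [← sum_mul_indicator_rect W (X j) (Y j), Finset.mul_sum]
            refine Finset.sum_congr rfl fun U _ => ?_
            rw [Finset.mul_sum]
    rw [h1]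
    calc ∑ j, w j * ∑ U ∈ X j, ∑ M ∈ Y j, W U M
        ≤ ∑ j, w j * (2 : ℝ) ^ (-(δ * m)) :=
          Finset.sum_le_sum fun j _ => mul_le_mul_of_nonneg_left (hrect (X j) (Y j)) (hw0 j)
      _ = (∑ j, w j) * (2 : ℝ) ^ (-(δ * m)) := by rw [Finset.sum_mul]
      _ ≤ (L : ℝ) ^ 2 * (2 : ℝ) ^ (-(δ * m)) :=
          mul_le_mul_of_nonneg_right hwsum (by positivity)
  have hlower : (1 / 24 : ℝ) ≤ Φ := by
    have hsplit : Φ = (∑ U : TCut N t, ∑ M : PMatch N, Wpos U M * twoRunStat (crossCount U.1 M.1))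
        - (∑ U : TCut N t, ∑ M : PMatch N, Wneg U M * twoRunStat (crossCount U.1 M.1))
        - (∑ U : TCut N t, ∑ M : PMatch N, Wpen U M * twoRunStat (crossCount U.1 M.1)) := by
      rw [hΦ]
      simp only [hW, sub_mul, Finset.sum_sub_distrib]
    have hP : ∑ U : TCut N t, ∑ M : PMatch N, Wpos U M * twoRunStat (crossCount U.1 M.1) = 3 / 8 := by
      have h3 : ∀ (U : TCut N t) (M : PMatch N),
          Wpos U M * twoRunStat (crossCount U.1 M.1) = Wpos U M * (3 / 8) := by
        intro U M
        by_cases h : Wpos U M = 0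
        · simp [h]
        · rw [hpos3 U M h, twoRunStat_three]
      calc ∑ U : TCut N t, ∑ M : PMatch N, Wpos U M * twoRunStat (crossCount U.1 M.1)
          = ∑ U : TCut N t, ∑ M : PMatch N, Wpos U M * (3 / 8) :=
            Finset.sum_congr rfl fun U _ => Finset.sum_congr rfl fun M _ => h3 U M
        _ = (∑ U : TCut N t, ∑ M : PMatch N, Wpos U M) * (3 / 8) := by
            rw [Finset.sum_mul]
            refine Finset.sum_congr rfl fun U _ => ?_
            rw [Finset.sum_mul]
        _ = 3 / 8 := by rw [hposSum, one_mul]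
    have hNg : ∑ U : TCut N t, ∑ M : PMatch N, Wneg U M * twoRunStat (crossCount U.1 M.1) ≤ 1 / 3 := by
      calc ∑ U : TCut N t, ∑ M : PMatch N, Wneg U M * twoRunStat (crossCount U.1 M.1)
          ≤ ∑ U : TCut N t, ∑ M : PMatch N, Wneg U M :=
            Finset.sum_le_sum fun U _ => Finset.sum_le_sum fun M _ => by
              calc Wneg U M * twoRunStat (crossCount U.1 M.1) ≤ Wneg U M * 1 :=
                    mul_le_mul_of_nonneg_left (twoRunStat_le_one _) (hneg0 U M)
                _ = Wneg U M := mul_one _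
        _ ≤ 1 / 3 := hnegSum
    have hPen : ∑ U : TCut N t, ∑ M : PMatch N, Wpen U M * twoRunStat (crossCount U.1 M.1) = 0 := by
      refine Finset.sum_eq_zero fun U _ => Finset.sum_eq_zero fun M _ => ?_
      by_cases h : Wpen U M = 0
      · simp [h]
      · rw [hpen1 U M h, twoRunStat_one, mul_zero]
    rw [hsplit, hP, hPen]
    linarith
  -- hence `1/24 ≤ (s+1)² · 2^{-δ m}`
  have hkey : (1 / 24 : ℝ) ≤ (L : ℝ) ^ 2 * (2 : ℝ) ^ (-(δ * m)) := hlower.trans hupper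
  have hs1 : (0 : ℝ) < (F.size : ℝ) + 1 := by positivity
  have hLr : (L : ℝ) ≤ (F.size : ℝ) + 1 := by exact_mod_cast hL
  have hL2 : (L : ℝ) ^ 2 ≤ ((F.size : ℝ) + 1) ^ 2 := pow_le_pow_left₀ (Nat.cast_nonneg L) hLr 2
  have hkey2 : (1 / 24 : ℝ) ≤ ((F.size : ℝ) + 1) ^ 2 * (2 : ℝ) ^ (-(δ * m)) :=
    hkey.trans (mul_le_mul_of_nonneg_right hL2 (by positivity))
  have h2δ : (0 : ℝ) < (2 : ℝ) ^ (δ * m) := by positivity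
  have hkey3 : (2 : ℝ) ^ (δ * m) / 24 ≤ ((F.size : ℝ) + 1) ^ 2 := by
    have h' : (1 / 24 : ℝ) ≤ ((F.size : ℝ) + 1) ^ 2 / (2 : ℝ) ^ (δ * m) := by
      rwa [Real.rpow_neg (by norm_num : (0 : ℝ) ≤ 2), ← div_eq_mul_inv] at hkey2
    rw [le_div_iff₀ h2δ] at h'
    have e : (2 : ℝ) ^ (δ * m) / 24 = 1 / 24 * (2 : ℝ) ^ (δ * m) := by ring
    rw [e]
    exact h'
  -- `2^{δ m / 2} ≤ 2^{δ m}/24` since `2^{δ m/2} ≥ 32`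
  have hhalf : (2 : ℝ) ^ (δ * m / 2) ≤ (2 : ℝ) ^ (δ * m) / 24 := by
    have h32 : (32 : ℝ) ≤ (2 : ℝ) ^ (δ * m / 2) := by
      calc (32 : ℝ) = (2 : ℝ) ^ ((5 : ℕ) : ℝ) := by rw [Real.rpow_natCast]; norm_num
        _ ≤ (2 : ℝ) ^ (δ * m / 2) :=
            Real.rpow_le_rpow_of_exponent_le one_le_two (by push_cast; linarith)
    have hsq : (2 : ℝ) ^ (δ * m) = (2 : ℝ) ^ (δ * m / 2) * (2 : ℝ) ^ (δ * m / 2) := by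
      rw [← Real.rpow_add (by norm_num : (0 : ℝ) < 2)]
      ring_nf
    rw [le_div_iff₀ (by norm_num : (0 : ℝ) < 24), hsq]
    have h0 : (0 : ℝ) ≤ (2 : ℝ) ^ (δ * m / 2) := by positivity
    nlinarith
  -- `y := 2^{c m}`, `c = δ/8`: `y⁴ = 2^{δ m/2} ≤ (s+1)²`, so `y² ≤ s + 1` and `y ≤ y² - 1 ≤ s`
  have hy0 : (0 : ℝ) ≤ (2 : ℝ) ^ (c * m) := by positivity
  have hy2 : (2 : ℝ) ≤ (2 : ℝ) ^ (c * m) := by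
    calc (2 : ℝ) = 2 ^ (1 : ℝ) := (Real.rpow_one 2).symm
      _ ≤ 2 ^ (c * m) := Real.rpow_le_rpow_of_exponent_le one_le_two hcm1
  have hy4 : (2 : ℝ) ^ (δ * m / 2) = ((2 : ℝ) ^ (c * m) * (2 : ℝ) ^ (c * m)) *
      ((2 : ℝ) ^ (c * m) * (2 : ℝ) ^ (c * m)) := by
    rw [← Real.rpow_add two_pos, ← Real.rpow_add two_pos, hc_def]
    ring_nf
  have hsq_le : (2 : ℝ) ^ (c * m) * (2 : ℝ) ^ (c * m) ≤ (F.size : ℝ) + 1 := by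
    have h4 : ((2 : ℝ) ^ (c * m) * (2 : ℝ) ^ (c * m)) * ((2 : ℝ) ^ (c * m) * (2 : ℝ) ^ (c * m)) ≤
        ((F.size : ℝ) + 1) ^ 2 := hy4 ▸ (hhalf.trans hkey3)
    nlinarith [h4, hy0, hs1, mul_nonneg hy0 hy0]
  rw [hfs]
  have key : (2 : ℝ) ^ (c * m) ≤ (F.size : ℝ) := by nlinarith [hsq_le, hy2]
  exact key

/-- Wiring check: the registered stubs feed `RazWigdersonMatching_of` exactly as stated, so the
skeleton is `RazWigdersonMatching` closed modulo the three stubs (sorries enter only through them). -/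
example : RazWigdersonMatching :=
  RazWigdersonMatching_of stub_kwPartition stub_plantedTwoRun stub_rothvossWeights

/-- Wiring check with the `def`s: once the three statements are theorems, the crux follows. -/
example (h₁ : MonotoneKWPartition) (h₂ : PlantedTwoRunStatistic) (h₃ : RothvossWeightDatum) :
    RazWigdersonMatching :=
  RazWigdersonMatching_of h₁ h₂ h₃

end Summit.ValiantsHypothesis.ValiantsHypothesis.Cruxes.RazWigdersonMatching.RothvossPlanted
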